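import Summits.BirchSwinnertonDyer.Rank1Residual.Additive.XMultRankZeroCyclotomicThreeX4Lemma20
import Literature.NumberTheory.EllipticCurves.Wuthrich2014.ThreeAdicImageSupersingularProofs
import HarnessLib

/-!
# Line V15 (X4 at `p = 3`, multiplicative twist): the `…_of_lemma20` consumers WITHOUT the binder `hL20`

HONEST FRAMING (cell `b2b-bsdres`, run/shared/lean/b2b/bsd-rank1-residual/, verbatim in every
file): the goal of the cell is to DELETE the COMBINATION-SHAPED residual classes of the
Birch–Swinnerton-Dyer formula for ALL analytic-rank `≤ 1` elliptic curves over `ℚ` — "full BSD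
formula for every rank `≤ 1` curve in class `C`" assembled STRICTLY from published theorems — so
that the rank-`≤ 1` remainder becomes exactly the CONSTRUCTION-SHAPED classes, which are TYPED
(missing-input `Prop`s), NOT attempted. This is not "finishing BSD". Team n1011 (N10 / N11), seat
p05, OWNERS row T-b1ss = the `hL20`-BINDER SWEEP: Wuthrich's Lemma 20 (registry A9, the named fact
`Wuthrich2014.lemma20_surjective_threeAdic_of_semistable`: at a prime-to-`9` conductor, `ρ̄_{E,3}`
onto ⟹ `ρ̄_{E,3ⁿ}` onto for all `n`) is a tree THEOREM since 2026-08-21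
(`Wuthrich2014.lemma20_surjective_threeAdic_of_semistable_holds`, file
`Literature/NumberTheory/EllipticCurves/Wuthrich2014/ThreeAdicImageSupersingularProofs.lean`, units
lit-kato / n1011-p02), so every theorem of the cell carrying it as a hypothesis has a twin WITHOUT that
binder.  This file states those twins for the theorems of its sibling (suffix `_noL20`; statement =
the sibling's statement with the binder deleted; proof = the sibling's theorem fed with `_holds`).
No claim beyond the stated classes; labels UNCHANGED; nothing is booked.  Theorems only (no
definition, no named fact minted).

## What this file proves

Binder-free twins of the four theorems of `Additive/XMultRankZeroCyclotomicThreeX4Lemma20.lean`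
(additive lane, line V15: `W ≅ V^{(−3)}` additive at `3` with `V` multiplicative at `3`):
`forall_surj_pow_of_twist_of_surj_noL20` (the `3`-adic tower of `V` from `surj(3)` of `W`),
`XMultCyclotomicThree.exists_padicVal_shaOrder_add_le_of_facts_of_surj_noL20` (core inequality),
`XMultCyclotomicThree.missingUpperBoundAt_of_facts_of_surj_noL20` (typed UPPER half),
`XMultCyclotomicThree.bsdp_of_shaAn_units_of_facts_of_surj_noL20` (`BSD(W,3) ∧ BSD(V,3)` on the
doubly-unit rows).  The remaining hypotheses are the sibling's, unchanged.

References: [Wuthrich2014] C. Wuthrich, Doc. Math. 19 (2014), Lemma 20 (p. 399), Cor. 19, Thm. 3;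
[GreenbergLNM1716] R. Greenberg, LNM 1716, §4.
-/

noncomputable section

open CongruenceSubgroup WeierstrassCurve NumberField IsDedekindDomain
  Literature.NumberTheory.EllipticCurves Literature.NumberTheory.EllipticCurves.ModularForms
  Literature.NumberTheory.EllipticCurves.Rank1Residual
  Literature.NumberTheory.EllipticCurves.Rank1Residual.Typed
  Literature.NumberTheory.GaloisRepresentations

namespace Summit.BirchSwinnertonDyer.Rank1Residual.Additive

variable (V : WeierstrassCurve ℚ) [V.IsElliptic] [V.IsGloballyMinimal]
  (W : WeierstrassCurve ℚ) [W.IsElliptic] [W.IsGloballyMinimal]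

omit [V.IsGloballyMinimal] [W.IsElliptic] [W.IsGloballyMinimal] in
/-- **Binder-free twin of `forall_surj_pow_of_twist_of_surj_of_lemma20`**: the same statement WITHOUT the hypothesis
`Wuthrich2014.lemma20_surjective_threeAdic_of_semistable` (now the tree theorem `…_holds`).
[cite: Wuthrich2014, Lemma 20 (p. 399)] -/
theorem forall_surj_pow_of_twist_of_surj_noL20
    (C : VariableChange ℚ) (hC : C • V.quadraticTwist (-(3 : ℚ)) = W)
    (hmult : V.HasMultiplicativeReductionAtPrime 3) (hsurj : Surj W 3) (n : ℕ) :
    V.HasSurjectiveModNGaloisRep (3 ^ n : ℕ) :=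
  forall_surj_pow_of_twist_of_surj_of_lemma20 V W
    Wuthrich2014.lemma20_surjective_threeAdic_of_semistable_holds C hC hmult hsurj n

/-- **Binder-free twin of `XMultCyclotomicThree.exists_padicVal_shaOrder_add_le_of_facts_of_surj_of_lemma20`**: the same statement WITHOUT the hypothesis
`Wuthrich2014.lemma20_surjective_threeAdic_of_semistable` (now the tree theorem `…_holds`).
[cite: GreenbergLNM1716, §4 pp. 112–113]
[cite: Wuthrich2014, Lemma 20 (p. 399)] -/
theorem XMultCyclotomicThree.exists_padicVal_shaOrder_add_le_of_facts_of_surj_noL20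
    (hKato : Wuthrich2014.kato_charIdeal_dvd_nonsplitMultiplicative_cyclotomicThree_of_surjective)
    (hGr : Greenberg1999.thm41Analogue_charValue_rankZero_numberField)
    (hMilne : Milne1972.bsdQuotient_baseChange_quadratic_anyModel)
    (hGZK : rank_eq_analyticRank_of_analyticRank_le_one) (hmod : hasEntireLFunction_rat)
    (hmodD : nonempty_modularParametrizationData)
    (C : VariableChange ℚ) (hC : C • V.quadraticTwist (-(3 : ℚ)) = W)
    (hmult : V.HasMultiplicativeReductionAtPrime 3) (hns : ¬ V.HasSplitMultiplicativeReductionAtPrime 3)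
    (hsurj : Surj W 3) (hadd : Addv W 3) (hrV : V.analyticRank = 0) (hrW : W.analyticRank = 0) :
    ∃ qV qW : ℚ, shaAn V = (qV : ℂ) ∧ shaAn W = (qW : ℂ) ∧
      (padicValNat 3 V.shaOrder : ℤ) + padicValNat 3 W.shaOrder ≤ padicValRat 3 qV + padicValRat 3 qW :=
  XMultCyclotomicThree.exists_padicVal_shaOrder_add_le_of_facts_of_surj_of_lemma20 V W hKato hGr Wuthrich2014.lemma20_surjective_threeAdic_of_semistable_holds
    hMilne hGZK hmod hmodD C hC hmult hns hsurj hadd hrV hrW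

/-- **Binder-free twin of `XMultCyclotomicThree.missingUpperBoundAt_of_facts_of_surj_of_lemma20`**: the same statement WITHOUT the hypothesis
`Wuthrich2014.lemma20_surjective_threeAdic_of_semistable` (now the tree theorem `…_holds`).
[cite: Wuthrich2014, Lemma 20 (p. 399)] -/
theorem XMultCyclotomicThree.missingUpperBoundAt_of_facts_of_surj_noL20
    (hKato : Wuthrich2014.kato_charIdeal_dvd_nonsplitMultiplicative_cyclotomicThree_of_surjective)
    (hGr : Greenberg1999.thm41Analogue_charValue_rankZero_numberField)
    (hMilne : Milne1972.bsdQuotient_baseChange_quadratic_anyModel)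
    (hGZK : rank_eq_analyticRank_of_analyticRank_le_one) (hmod : hasEntireLFunction_rat)
    (hmodD : nonempty_modularParametrizationData)
    (C : VariableChange ℚ) (hC : C • V.quadraticTwist (-(3 : ℚ)) = W)
    (hmult : V.HasMultiplicativeReductionAtPrime 3) (hns : ¬ V.HasSplitMultiplicativeReductionAtPrime 3)
    (hsurj : Surj W 3) (hadd : Addv W 3) (hrV : V.analyticRank = 0) (hrW : W.analyticRank = 0)
    {qV : ℚ} (hqV : shaAn V = (qV : ℂ)) (hv : padicValRat 3 qV ≤ 0) :
    MissingUpperBoundAt W 3 :=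
  XMultCyclotomicThree.missingUpperBoundAt_of_facts_of_surj_of_lemma20 V W hKato hGr Wuthrich2014.lemma20_surjective_threeAdic_of_semistable_holds hMilne hGZK
    hmod hmodD C hC hmult hns hsurj hadd hrV hrW hqV hv

/-- **Binder-free twin of `XMultCyclotomicThree.bsdp_of_shaAn_units_of_facts_of_surj_of_lemma20`**: the same statement WITHOUT the hypothesis
`Wuthrich2014.lemma20_surjective_threeAdic_of_semistable` (now the tree theorem `…_holds`).
[cite: GreenbergLNM1716, §4 pp. 112–113]
[cite: Wuthrich2014, Lemma 20 (p. 399)] -/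
theorem XMultCyclotomicThree.bsdp_of_shaAn_units_of_facts_of_surj_noL20
    (hKato : Wuthrich2014.kato_charIdeal_dvd_nonsplitMultiplicative_cyclotomicThree_of_surjective)
    (hGr : Greenberg1999.thm41Analogue_charValue_rankZero_numberField)
    (hMilne : Milne1972.bsdQuotient_baseChange_quadratic_anyModel)
    (hGZK : rank_eq_analyticRank_of_analyticRank_le_one) (hmod : hasEntireLFunction_rat)
    (hmodD : nonempty_modularParametrizationData)
    (C : VariableChange ℚ) (hC : C • V.quadraticTwist (-(3 : ℚ)) = W)
    (hmult : V.HasMultiplicativeReductionAtPrime 3) (hns : ¬ V.HasSplitMultiplicativeReductionAtPrime 3)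
    (hsurj : Surj W 3) (hadd : Addv W 3) (hrV : V.analyticRank = 0) (hrW : W.analyticRank = 0)
    {qV qW : ℚ} (hqV : shaAn V = (qV : ℂ)) (hqW : shaAn W = (qW : ℂ))
    (hvV : padicValRat 3 qV = 0) (hvW : padicValRat 3 qW = 0) : BSDp W 3 ∧ BSDp V 3 :=
  XMultCyclotomicThree.bsdp_of_shaAn_units_of_facts_of_surj_of_lemma20 V W hKato hGr Wuthrich2014.lemma20_surjective_threeAdic_of_semistable_holds hMilne hGZK
    hmod hmodD C hC hmult hns hsurj hadd hrV hrW hqV hqW hvV hvW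

end Summit.BirchSwinnertonDyer.Rank1Residual.Additive

end
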